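import Literature.AlgebraicGeometry.Resolution.SmoothFibreCriterionPointwise
import Literature.AlgebraicGeometry.Resolution.RegularLocusPerfectField
import Literature.AlgebraicGeometry.Resolution.SmoothBaseChangeField
import Literature.AlgebraicGeometry.Resolution.RegularLocalRingsFlatDescent
import Literature.AlgebraicGeometry.Resolution.SmoothImpliesRegular
import Mathlib.FieldTheory.PurelyInseparable.PerfectClosure
import HarnessLib

/-!
# Regular points of a perfect-field-valued fibre lie over the smooth locus (Stacks 038X with 01V8)

Topic: `Literature/AlgebraicGeometry/Resolution`. A brick for the SPECIALIZATION step of the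
large-characteristic resolution statements obtained by spreading out from characteristic zero
(`SpreadsShapedFromGenericPoint`, `CanonicalResolutionSpread.lean`, whose docstring announces
"the smooth locus of `Y/B` specializing to the regular locus over a perfect field";
`BierstoneGrigorievMilmanWlodarczyk2011_embedded`, `EmbeddedResolution.lean`, whose conclusion
quantifies over the regular locus `Reg(Y)` of the INPUT `Y ⊆ 𝔸ⁿ_k`, `k` perfect). The spread-out
family `𝒴 → Spec A` is flat and of finite presentation (generic flatness after shrinking), the
positions of the centres relative to the smooth locus `Sm(𝒴/A)` are spread from the generic
fibre, and the input over a perfect field `k` is the fibre `𝒴 ×_A Spec k` at a `k`-valued point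
`A → k` whose kernel `𝔭` need NOT have a perfect residue field `κ(𝔭)` and over which `k` need
not be algebraic. What is needed is therefore: **a point of `𝒴 ×_A Spec k` at which this
`k`-scheme is regular lies over a point of `Sm(𝒴/A)`** (and conversely every point over
`Sm(𝒴/A)` is a regular point, for any field `k`). Everything here is PROVED, affine (ring)
form — `A → B` flat of finite presentation, `A → k` with `k` a perfect field, `Q` a prime of
`k ⊗_A B`:

* `isRegularLocalRing_localization_comap_ringEquiv` — bookkeeping: regularity of local rings
  at corresponding primes along a ring isomorphism.
* `isSmoothAt_of_isRegularLocalRing_tensor_of_perfectField_between`,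
  `isSmoothAt_of_isRegularLocalRing_tensor_perfectField` — **the field case** (The Stacks
  Project, Tag 038X: "`X` is geometrically regular at `x` if and only if `X → Spec(k)` is smooth
  at `x`", here from regularity after ONE perfect extension, which implies geometric
  regularity): `F` of finite type over a field `κ`, `k ⊇ κ` ANY perfect extension field,
  `Q ⊂ k ⊗_κ F` prime with `(k ⊗_κ F)_Q` regular ⇒ `F` is `κ`-smooth at `Q ∩ F`. Proof: let
  `K ⊆ k` be the perfect closure of `κ` in `k` (Mathlib `perfectClosure`; perfect since `k` is,
  purely inseparable over `κ`); `k ⊗_κ F = k ⊗_K (K ⊗_κ F)` is flat over `K ⊗_κ F`, so regularity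
  DESCENDS to `(K ⊗_κ F)_{Q ∩ (K ⊗_κ F)}` (Matsumura Thm. 23.7 (i), tree
  `IsRegularLocalRing.of_flat_of_isLocalHom`; cf. Tag 05AW); over the PERFECT field `K` regular =
  smooth (Tag 00TV, tree `isSmoothAt_iff_isRegularLocalRing_of_perfectField`);
  `Spec(K ⊗_κ F) → Spec F` is injective (`K/κ` radicial, tree `eq_of_comap_includeRight_eq`), so
  `K ⊗_κ F` is `K`-smooth at EVERY prime over `Q ∩ F`, and smoothness descends along the
  algebraic extension `K/κ` (Tag 02VL "smoothness is fpqc local on the base", pointwise form of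
  the tree, `isSmoothAt_of_forall_isSmoothAt_baseChange`).
* `isSmoothAt_of_isRegularLocalRing_tensor_perfectField_of_flat` — **the relative case** (fibre
  criterion of smoothness, Tags 01V8/00TF, + the above): `(k ⊗_A B)_Q` regular ⇒ `B` is
  `A`-smooth at `Q ∩ B`. Proof: with `𝔭 = ker(A → k)`, `k ⊗_A B = k ⊗_{κ(𝔭)} (κ(𝔭) ⊗_A B)`
  (Mathlib `cancelBaseChange`), the field case gives smoothness of the fibre ring `κ(𝔭) ⊗_A B`
  over `κ(𝔭)` at the contraction, and the pointwise fibre criterion (Tag 00TF, tree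
  `isSmoothAt_comap_iff_isSmoothAt_fiber`) concludes by flatness.
* `isRegularLocalRing_tensor_of_isSmoothAt` — the converse (any field `k`, no flatness):
  `B` `A`-smooth at `Q ∩ B` ⇒ `(k ⊗_A B)_Q` regular (base change of smoothness, tree
  `isSmoothAt_baseChange`; smooth over a field ⇒ regular, tree `isRegularLocalRing_of_isSmoothAt`);
  `isRegularLocalRing_tensor_iff_isSmoothAt` — the equivalence; `isRegularLocalRing_tensor_iff_isSmoothAt'`
  — the same for `B ⊗_A k` (base field on the right, the convention of the affine charts of
  `CompletedPullbackRegular.lean`).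

## Sources

* The Stacks Project, Tag 038X (Varieties, Lemma 33.12.6: geometrically regular at `x` ⇔ smooth
  at `x`), Tag 05AW (Lemma 33.12.5: geometric regularity descends along flat morphisms),
  Tag 00TV (Algebra, Lemma 10.140.5), Tag 02VL (Descent, Lemma 35.23.29: smoothness is fpqc
  local on the base), Tags 00TF (Algebra, Lemma 10.137.16) / 01V8 (Morphisms, Lemma 29.35.3)
  (fibre criterion of smoothness). [StacksProject]
* H. Matsumura, *Commutative Ring Theory*, CUP 1986, Thm. 23.7 (i) (regularity descends along
  flat local homomorphisms). [Matsumura1987]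
-/

noncomputable section

namespace Literature.AlgebraicGeometry.Resolution

universe u

open IsLocalRing TensorProduct

/-! ## Regularity at corresponding primes along a ring isomorphism -/

/-- Along a ring isomorphism `e : R ≃ R'`, the local ring of `R` at `e⁻¹(Q)` is regular when
the local ring of `R'` at `Q` is (the localizations are isomorphic). [folklore] -/
theorem isRegularLocalRing_localization_comap_ringEquiv {R R' : Type*} [CommRing R]
    [CommRing R'] (e : R ≃+* R') (Q : Ideal R') [Q.IsPrime]
    [IsRegularLocalRing (Localization.AtPrime Q)] :
    IsRegularLocalRing (Localization.AtPrime (Q.comap e.toRingHom)) := by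
  have hM : (Q.comap e.toRingHom).primeCompl.map e.toRingHom.toMonoidHom = Q.primeCompl := by
    ext y
    simp only [Submonoid.mem_map, Ideal.mem_primeCompl_iff, Ideal.mem_comap,
      RingHom.toMonoidHom_eq_coe, MonoidHom.coe_coe, RingEquiv.toRingHom_eq_coe,
      RingEquiv.coe_toRingHom]
    constructor
    · rintro ⟨x, hx, rfl⟩
      exact hx
    · intro hy
      exact ⟨e.symm y, by rwa [e.apply_symm_apply], e.apply_symm_apply y⟩
  let e' : Localization.AtPrime (Q.comap e.toRingHom) ≃+* Localization.AtPrime Q :=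
    IsLocalization.ringEquivOfRingEquiv (Localization.AtPrime (Q.comap e.toRingHom))
      (Localization.AtPrime Q) e hM
  exact IsRegularLocalRing.of_ringEquiv e'.symm

/-! ## The field case: a regular point of `k ⊗_κ F`, `k` perfect, lies over a smooth point of `F/κ` -/

section FieldCase

variable (κ : Type u) [Field κ] (F : Type u) [CommRing F] [Algebra κ F] [Algebra.FiniteType κ F]
  (k : Type u) [Field k] [Algebra κ k]

/-- The field case through a given intermediate perfect, purely inseparable extension `K` of
`κ` inside `k` (for `k` perfect, the perfect closure of `κ` in `k` is one,
`isSmoothAt_of_isRegularLocalRing_tensor_perfectField`): `F` of finite type over `κ`,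
`κ ⊆ K ⊆ k` fields with `K` perfect and purely inseparable over `κ`, `Q ⊂ k ⊗_κ F` a prime with
regular local ring ⇒ `F` is `κ`-smooth at `Q ∩ F`. Proof: `k ⊗_κ F = k ⊗_K (K ⊗_κ F)` is flat
over `K ⊗_κ F`, so regularity descends to `(K ⊗_κ F)_{Q ∩ (K ⊗_κ F)}` (Matsumura 23.7 (i)); over
the perfect `K` regular = smooth (Stacks 00TV); `Spec(K ⊗_κ F) → Spec F` is injective (`K/κ`
radicial), so `K ⊗_κ F` is `K`-smooth at every prime over `Q ∩ F` and smoothness descends along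
the algebraic extension `K/κ` (Stacks 02VL). [cite: StacksProject, Tag 038X with Tags 05AW, 00TV, 02VL] -/
theorem isSmoothAt_of_isRegularLocalRing_tensor_of_perfectField_between (K : Type u) [Field K]
    [Algebra κ K] [Algebra K k] [IsScalarTower κ K k] [PerfectField K] [IsPurelyInseparable κ K]
    (Q : Ideal (k ⊗[κ] F)) [Q.IsPrime] [IsRegularLocalRing (Localization.AtPrime Q)] :
    Algebra.IsSmoothAt κ (Q.comap (Algebra.TensorProduct.includeRight (R := κ) (A := k) :
        F →ₐ[κ] k ⊗[κ] F).toRingHom) := by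
  classical
  -- notation: `q = Q ∩ F`; `ψ : K ⊗ F → k ⊗ F`
  set q : Ideal F := Q.comap (Algebra.TensorProduct.includeRight (R := κ) (A := k) :
    F →ₐ[κ] k ⊗[κ] F).toRingHom with hqdef
  let ψ : (K ⊗[κ] F) →ₐ[K] k ⊗[κ] F :=
    Algebra.TensorProduct.map (Algebra.ofId K k) (AlgHom.id κ F)
  letI : Algebra (K ⊗[κ] F) (k ⊗[κ] F) := ψ.toRingHom.toAlgebra
  have hψ : ∀ x : F, ψ ((1 : K) ⊗ₜ[κ] x) = (1 : k) ⊗ₜ[κ] x := fun x => by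
    simp only [ψ, Algebra.TensorProduct.map_tmul, map_one, AlgHom.coe_id, id_eq]
  haveI : IsScalarTower K (K ⊗[κ] F) (k ⊗[κ] F) :=
    IsScalarTower.of_algebraMap_eq fun c => (ψ.commutes c).symm
  -- `k ⊗_κ F = k ⊗_K (K ⊗_κ F)` is flat over `K ⊗_κ F`
  have hpo : Algebra.IsPushout K k (K ⊗[κ] F) (k ⊗[κ] F) :=
    Algebra.IsPushout.tensorProduct_tensorProduct κ F K k (RingHom.ext fun x => by
      change ψ ((1 : K) ⊗ₜ[κ] x) = (1 : k) ⊗ₜ[κ] x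
      exact hψ x)
  haveI : Module.Flat (K ⊗[κ] F) (k ⊗[κ] F) :=
    Module.Flat.isBaseChange K (K ⊗[κ] F) k (N := k ⊗[κ] F) hpo.symm.out
  -- the contraction `Q₁ = Q ∩ (K ⊗ F)` and descent of regularity to it
  let Q₁ : Ideal (K ⊗[κ] F) := Q.under (K ⊗[κ] F)
  haveI hNoeth : IsNoetherianRing (K ⊗[κ] F) := Algebra.FiniteType.isNoetherianRing K _
  have hreg₁ : IsRegularLocalRing (Localization.AtPrime Q₁) := by
    let A₁ := Localization.AtPrime Q₁
    let B₁ := Localization.AtPrime Q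
    letI : Algebra A₁ B₁ := Localization.AtPrime.algebraOfLiesOver Q₁ Q
    haveI : IsLocalHom (algebraMap A₁ B₁) := by
      rw [Localization.AtPrime.IsLiesOverAlgebra.algebraMap_eq (p := Q₁) (P := Q)]
      infer_instance
    haveI : Module.Flat (K ⊗[κ] F) B₁ := Module.Flat.trans (K ⊗[κ] F) (k ⊗[κ] F) B₁
    haveI : Module.Flat A₁ B₁ := (Module.flat_iff_of_isLocalization A₁ Q₁.primeCompl B₁).mpr ‹_›
    haveI : IsNoetherianRing A₁ := IsLocalization.isNoetherianRing Q₁.primeCompl A₁ hNoeth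
    exact IsRegularLocalRing.of_flat_of_isLocalHom A₁ B₁
  -- over the perfect field `K`, regular = smooth
  have hsmK : Algebra.IsSmoothAt K Q₁ :=
    (isSmoothAt_iff_isRegularLocalRing_of_perfectField K (K ⊗[κ] F) Q₁).mpr hreg₁
  -- `Q₁` lies over `q`
  have hQ₁ : Q₁.comap (Algebra.TensorProduct.includeRight (R := κ) (A := K) :
      F →ₐ[κ] K ⊗[κ] F).toRingHom = q := by
    ext x
    simp only [Ideal.mem_comap, AlgHom.toRingHom_eq_coe, RingHom.coe_coe,
      Algebra.TensorProduct.includeRight_apply, hqdef, Q₁, Ideal.under_def]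
    change ψ ((1 : K) ⊗ₜ[κ] x) ∈ Q ↔ _
    rw [hψ]
  -- descent of smoothness along the algebraic (purely inseparable) extension `K/κ`:
  -- `Q₁` is the ONLY prime of `K ⊗ F` over `q`
  haveI : Algebra.FinitePresentation κ F := (Algebra.FinitePresentation.of_finiteType).mp ‹_›
  haveI : Algebra.IsAlgebraic κ K := IsPurelyInseparable.isAlgebraic κ K
  refine isSmoothAt_of_forall_isSmoothAt_baseChange (K := K) q fun Q' _ hQ' => ?_
  have hQ'eq : Q' = Q₁ :=
    eq_of_comap_includeRight_eq (l := κ) (l' := K) (A := F) (by rw [hQ₁]; exact hQ')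
  subst hQ'eq
  exact hsmK

/-- **Regular points of `k ⊗_κ F` over a perfect extension `k ⊇ κ` lie over smooth points of
`F/κ`** (The Stacks Project, Tag 038X "geometrically regular at `x` ⇔ smooth at `x`", in the
one-sided form from ONE perfect extension): `F` of finite type over the field `κ`, `k` a
PERFECT field containing `κ` (not necessarily algebraic over it), `Q ⊂ k ⊗_κ F` a prime whose
local ring is regular; then `F` is `κ`-smooth at `Q ∩ F` — the previous theorem for the perfect
closure of `κ` in `k` (Mathlib `perfectClosure`: perfect since `k` is, purely inseparable over
`κ`). [cite: StacksProject, Tag 038X with Tags 05AW, 00TV, 02VL] -/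
theorem isSmoothAt_of_isRegularLocalRing_tensor_perfectField [PerfectField k]
    (Q : Ideal (k ⊗[κ] F)) [Q.IsPrime] [IsRegularLocalRing (Localization.AtPrime Q)] :
    Algebra.IsSmoothAt κ (Q.comap (Algebra.TensorProduct.includeRight (R := κ) (A := k) :
        F →ₐ[κ] k ⊗[κ] F).toRingHom) :=
  isSmoothAt_of_isRegularLocalRing_tensor_of_perfectField_between κ F k (perfectClosure κ k) Q

end FieldCase

/-! ## The relative case: `A → B` flat of finite presentation, `A → k` perfect-field-valued point -/

section Relative

variable (A : Type u) [CommRing A] (B : Type u) [CommRing B] [Algebra A B]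
  (k : Type u) [Field k] [Algebra A k]

/-- **Points over the smooth locus are regular points of the fibre** (any field `k`): if `B`
is of finite presentation over `A` and `A`-smooth at `Q ∩ B`, then `(k ⊗_A B)_Q` is a regular
local ring (`k ⊗_A B` is `k`-smooth at `Q` by base change, and smooth over a field implies
regular). [cite: StacksProject, Tag 00TV (smooth ⇒ regular) with base change of smoothness] -/
theorem isRegularLocalRing_tensor_of_isSmoothAt [Algebra.FinitePresentation A B]
    (Q : Ideal (k ⊗[A] B)) [Q.IsPrime]
    [Algebra.IsSmoothAt A (Q.comap (Algebra.TensorProduct.includeRight (R := A) (A := k) :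
        B →ₐ[A] k ⊗[A] B).toRingHom)] :
    IsRegularLocalRing (Localization.AtPrime Q) := by
  haveI : Algebra.IsSmoothAt k Q :=
    isSmoothAt_baseChange k (Q.comap (Algebra.TensorProduct.includeRight (R := A) (A := k) :
      B →ₐ[A] k ⊗[A] B).toRingHom) Q rfl
  exact isRegularLocalRing_of_isSmoothAt k (k ⊗[A] B) Q

variable [PerfectField k]

/-- **Regular points of a perfect-field-valued fibre lie over the smooth locus** (fibre
criterion of smoothness, The Stacks Project, Tags 01V8/00TF, combined with Tag 038X): `A → B`
flat of finite presentation, `A → k` a ring map to a PERFECT field (arbitrary kernel `𝔭`,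
`k ⊇ κ(𝔭)` arbitrary), `Q ⊂ k ⊗_A B` a prime whose local ring is regular. Then `B` is
`A`-smooth at `Q ∩ B`. Proof: `k ⊗_A B = k ⊗_{κ(𝔭)} (κ(𝔭) ⊗_A B)`; the field case
(`isSmoothAt_of_isRegularLocalRing_tensor_perfectField`) makes the fibre ring `κ(𝔭) ⊗_A B`
smooth over `κ(𝔭)` at the contraction of `Q`, and the pointwise fibre criterion of smoothness
(flatness) concludes. [cite: StacksProject, Tag 00TF with Tag 038X] -/
theorem isSmoothAt_of_isRegularLocalRing_tensor_perfectField_of_flat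
    [Algebra.FinitePresentation A B] [Module.Flat A B]
    (Q : Ideal (k ⊗[A] B)) [Q.IsPrime] [IsRegularLocalRing (Localization.AtPrime Q)] :
    Algebra.IsSmoothAt A (Q.comap (Algebra.TensorProduct.includeRight (R := A) (A := k) :
        B →ₐ[A] k ⊗[A] B).toRingHom) := by
  classical
  -- the point `𝔭 = ker (A → k)` and the embedding of its residue field into `k`
  let 𝔭 : Ideal A := RingHom.ker (algebraMap A k)
  haveI h𝔭 : 𝔭.IsPrime := RingHom.ker_isPrime _
  let κ : Type u := 𝔭.ResidueField
  let ι : κ →+* k := Ideal.ResidueField.lift 𝔭 (algebraMap A k) le_rfl (fun a ha => by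
    simp only [Submonoid.mem_comap, IsUnit.mem_submonoid_iff]
    exact (Ne.isUnit (fun h => ha ((RingHom.mem_ker).mpr h))))
  letI : Algebra κ k := ι.toAlgebra
  haveI : IsScalarTower A κ k := IsScalarTower.of_algebraMap_eq fun a => by
    change algebraMap A k a = ι (algebraMap A κ a)
    exact (Ideal.ResidueField.lift_algebraMap 𝔭 (algebraMap A k) le_rfl _ a).symm
  -- `k ⊗_A B = k ⊗_κ (κ ⊗_A B)`
  let e : k ⊗[κ] (κ ⊗[A] B) ≃ₐ[k] k ⊗[A] B := Algebra.TensorProduct.cancelBaseChange A κ k k B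
  let Q' : Ideal (k ⊗[κ] (κ ⊗[A] B)) := Q.comap e.toRingEquiv.toRingHom
  haveI : Q'.IsPrime := Ideal.comap_isPrime _ Q
  haveI : IsRegularLocalRing (Localization.AtPrime Q') :=
    isRegularLocalRing_localization_comap_ringEquiv e.toRingEquiv Q
  -- the field case for the fibre ring `κ ⊗_A B`
  haveI : Algebra.FiniteType A B := inferInstance
  haveI : Algebra.FiniteType κ (κ ⊗[A] B) := inferInstance
  have h1 := isSmoothAt_of_isRegularLocalRing_tensor_perfectField κ (κ ⊗[A] B) k Q'
  -- the fibre criterion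
  set q' : Ideal (κ ⊗[A] B) := Q'.comap (Algebra.TensorProduct.includeRight (R := κ) (A := k) :
    κ ⊗[A] B →ₐ[κ] k ⊗[κ] (κ ⊗[A] B)).toRingHom with hq'def
  haveI : q'.IsPrime := Ideal.comap_isPrime _ Q'
  have h2 := (isSmoothAt_comap_iff_isSmoothAt_fiber (R := A) (S := B) 𝔭 q').mpr h1
  -- the double contraction is `Q ∩ B`
  have hq : q'.comap (Algebra.TensorProduct.includeRight : B →ₐ[A] 𝔭.Fiber B) =
      Q.comap (Algebra.TensorProduct.includeRight (R := A) (A := k) :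
        B →ₐ[A] k ⊗[A] B).toRingHom := by
    ext b
    simp only [Ideal.mem_comap, AlgHom.toRingHom_eq_coe, RingHom.coe_coe,
      Algebra.TensorProduct.includeRight_apply, hq'def, Q']
    change e ((1 : k) ⊗ₜ[κ] ((1 : κ) ⊗ₜ[A] b)) ∈ Q ↔ (1 : k) ⊗ₜ[A] b ∈ Q
    rw [show e ((1 : k) ⊗ₜ[κ] ((1 : κ) ⊗ₜ[A] b)) = (1 : k) ⊗ₜ[A] b by
      simp [e, Algebra.TensorProduct.cancelBaseChange_tmul]]
  have key : ∀ (I : Ideal B) [I.IsPrime], I = Q.comap (Algebra.TensorProduct.includeRight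
      (R := A) (A := k) : B →ₐ[A] k ⊗[A] B).toRingHom → Algebra.IsSmoothAt A I →
      Algebra.IsSmoothAt A (Q.comap (Algebra.TensorProduct.includeRight (R := A) (A := k) :
        B →ₐ[A] k ⊗[A] B).toRingHom) := by
    rintro I _ rfl h
    exact h
  exact key _ hq h2

/-- **The regular locus of a perfect-field-valued fibre is the preimage of the smooth locus**
(ring form): for `A → B` flat of finite presentation, `A → k` with `k` perfect and a prime
`Q ⊂ k ⊗_A B`, the local ring `(k ⊗_A B)_Q` is regular iff `B` is `A`-smooth at `Q ∩ B`.
[cite: StacksProject, Tag 00TF with Tag 038X] -/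
theorem isRegularLocalRing_tensor_iff_isSmoothAt [Algebra.FinitePresentation A B]
    [Module.Flat A B] (Q : Ideal (k ⊗[A] B)) [Q.IsPrime] :
    IsRegularLocalRing (Localization.AtPrime Q) ↔
      Algebra.IsSmoothAt A (Q.comap (Algebra.TensorProduct.includeRight (R := A) (A := k) :
        B →ₐ[A] k ⊗[A] B).toRingHom) :=
  ⟨fun _ => isSmoothAt_of_isRegularLocalRing_tensor_perfectField_of_flat A B k Q,
    fun _ => isRegularLocalRing_tensor_of_isSmoothAt A B k Q⟩

/-- The same with the base-changed ring written `B ⊗_A k` (the convention of the affine charts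
`Spec (Γ(Y, W) ⊗_D E)` of `CompletedPullbackRegular.lean` / `BlowupsRelativeCartier.lean`): for
`A → B` flat of finite presentation, `k` perfect and a prime `P ⊂ B ⊗_A k`, the local ring
`(B ⊗_A k)_P` is regular iff `B` is `A`-smooth at `P ∩ B` (transport along `B ⊗_A k ≅ k ⊗_A B`).
[cite: StacksProject, Tag 00TF with Tag 038X] -/
theorem isRegularLocalRing_tensor_iff_isSmoothAt' [Algebra.FinitePresentation A B]
    [Module.Flat A B] (P : Ideal (B ⊗[A] k)) [P.IsPrime] :
    IsRegularLocalRing (Localization.AtPrime P) ↔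
      Algebra.IsSmoothAt A (P.comap (Algebra.TensorProduct.includeLeftRingHom (R := A) (A := B)
        (B := k))) := by
  let e : B ⊗[A] k ≃ₐ[A] k ⊗[A] B := Algebra.TensorProduct.comm A B k
  let Q : Ideal (k ⊗[A] B) := P.comap e.symm.toRingEquiv.toRingHom
  haveI hQ : Q.IsPrime := Ideal.comap_isPrime e.symm.toRingEquiv.toRingHom P
  have hQP : Q.comap (Algebra.TensorProduct.includeRight (R := A) (A := k) :
      B →ₐ[A] k ⊗[A] B).toRingHom =
      P.comap (Algebra.TensorProduct.includeLeftRingHom (R := A) (A := B) (B := k)) := by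
    ext b
    simp only [Ideal.mem_comap, AlgHom.toRingHom_eq_coe, RingHom.coe_coe,
      Algebra.TensorProduct.includeRight_apply, Q]
    change e.symm ((1 : k) ⊗ₜ[A] b) ∈ P ↔ b ⊗ₜ[A] (1 : k) ∈ P
    rw [show e.symm ((1 : k) ⊗ₜ[A] b) = b ⊗ₜ[A] (1 : k) from
      Algebra.TensorProduct.comm_symm_tmul (R := A) b (1 : k)]
  have hPQ : Q.comap e.toRingEquiv.toRingHom = P := by
    ext x
    simp only [Ideal.mem_comap, Q, RingEquiv.toRingHom_eq_coe, RingEquiv.coe_toRingHom,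
      AlgEquiv.coe_ringEquiv]
    rw [e.symm_apply_apply]
  -- transport of smoothness / regularity along the two ideal equalities
  have key₁ : ∀ (I : Ideal B) [I.IsPrime], Q.comap (Algebra.TensorProduct.includeRight (R := A)
      (A := k) : B →ₐ[A] k ⊗[A] B).toRingHom = I →
      (Algebra.IsSmoothAt A I ↔ Algebra.IsSmoothAt A (Q.comap (Algebra.TensorProduct.includeRight
        (R := A) (A := k) : B →ₐ[A] k ⊗[A] B).toRingHom)) := by
    rintro I _ rfl
    exact Iff.rfl
  have key₂ : ∀ (I : Ideal (B ⊗[A] k)) [I.IsPrime], Q.comap e.toRingEquiv.toRingHom = I →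
      IsRegularLocalRing (Localization.AtPrime (Q.comap e.toRingEquiv.toRingHom)) →
      IsRegularLocalRing (Localization.AtPrime I) := by
    rintro I _ rfl h
    exact h
  rw [key₁ _ hQP, ← isRegularLocalRing_tensor_iff_isSmoothAt A B k Q]
  constructor
  · intro hP
    exact isRegularLocalRing_localization_comap_ringEquiv e.symm.toRingEquiv P
  · intro hQreg
    haveI := hQreg
    exact key₂ P hPQ (isRegularLocalRing_localization_comap_ringEquiv e.toRingEquiv Q)

end Relative

end Literature.AlgebraicGeometry.Resolution

end
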